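import Summits.KontsevichZagierPeriods.KontsevichZagierPeriods.Theorems.SymplecticScissorsPlanarCompilerGreenAux3
import Literature.NumberTheory.Transcendental.SemialgebraicCubicalChain

/-!
# `PlanarK0Injective` (stmt-KontsevichZagierPeriods-9847) — line `kernel-subgroup-homotopy`,
stub `stub_chainToPlanar`: helper file (anchor `helper_chainToPlanar_1`)

Planar bookkeeping for the stub `stub_chainToPlanar` (cubical identity ⇒ planar identity) of
`SymplecticScissorsPlanarK0InjectiveChainToPlanar.lean`, in the planar set-chain group
`planarGroup`:

* `chainToPlanar_isSemialgebraic_cell`, `chainToPlanar_volume_cell_ne_top` — the cell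
  `{0 < x < 1, 0 < y < g x}` under a `ℚ`-semialgebraic density bounded above is a planar set;
* `chainToPlanar_cov_move` — rule 2 with `|det| = 1` between integrand-`1` planar representations;
* `chainToPlanar_affine_piece` (= the anchor `helper_chainToPlanar_1`) — the piece
  `{a < x < b, 0 < y < F x}` (`a < b` rational) is carried onto the standard cell of the rescaled
  density `u ↦ (b − a) F (a + (b − a) u)` by the affine map `(x, y) ↦ ((x − a)/(b − a), (b − a) y)`;
* `chainToPlanar_dens_sa_bdd` — the edge density `t ↦ Σᵢ Pᵢ (c t) (∂c(t) e₀)ᵢ` of a 1-cube mapping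
  `[0, 1]` into `S` is `ℚ`-semialgebraic and bounded on `(0, 1)`.

No new definitions. [Kontsevich–Zagier 2001, §1.2; Bochnak–Coste–Roy 1998, §2.2; folklore]
-/

noncomputable section

open MeasureTheory Set Filter
open scoped Topology
open Literature.NumberTheory.Transcendental Literature.ModelTheory.ExponentialFields
open Summit.KontsevichZagierPeriods.SymplecticScissors.PlanarK0InjectiveNegative
open Summit.KontsevichZagierPeriods.SymplecticScissors.PlanarCompilerProof

namespace Summit.KontsevichZagierPeriods.SymplecticScissors.KernelSubgroupHomotopy


/-! ## Cells under a density -/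

/-- The cell `{0 < x < 1, 0 < y < g x}` under a `ℚ`-semialgebraic density `g` on `(0, 1)` is
`ℚ`-semialgebraic (`y − g x` is a semialgebraic function on the strip; Tarski–Seidenberg).
[Bochnak–Coste–Roy 1998, Prop. 2.2.6; folklore] -/
theorem chainToPlanar_isSemialgebraic_cell {g : ℝ → ℝ}
    (hsa : IsSemialgebraicFunOn ℚ {z : Fin 1 → ℝ | z 0 ∈ Ioo (0 : ℝ) 1} (fun z => g (z 0))) :
    IsSemialgebraic ℚ {p : Fin 2 → ℝ | p 0 ∈ Ioo (0 : ℝ) 1 ∧ 0 < p 1 ∧ p 1 < g (p 0)} := by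
  -- adapted from `MordellWeil.scalar_isSemialgebraic_cell` (ScalarCalculus), without the scalar `t`
  have hS : IsSemialgebraic ℚ {p : Fin 2 → ℝ | p 0 ∈ Ioo (0 : ℝ) 1} := by
    simpa using isSemialgebraic_coord_Ioo (0 : Fin 2) 0 1
  have hπ : IsSemialgebraicMapOn ℚ {p : Fin 2 → ℝ | p 0 ∈ Ioo (0 : ℝ) 1}
      (fun (q : Fin 2 → ℝ) (_ : Fin 1) => q 0) := by
    simpa using isSemialgebraicMapOn_aeval hS
      (fun _ : Fin 1 => (MvPolynomial.X 0 : MvPolynomial (Fin 2) ℚ))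
  have hg0 : IsSemialgebraicFunOn ℚ {p : Fin 2 → ℝ | p 0 ∈ Ioo (0 : ℝ) 1} (fun q => g (q 0)) :=
    IsSemialgebraicFunOn.comp_isSemialgebraicMapOn_holds hsa hπ fun q hq => hq
  have h1 : IsSemialgebraicFunOn ℚ {p : Fin 2 → ℝ | p 0 ∈ Ioo (0 : ℝ) 1} (fun q => q 1) := by
    simpa using isSemialgebraicFunOn_aeval hS (MvPolynomial.X 1 : MvPolynomial (Fin 2) ℚ)
  have hG : IsSemialgebraicFunOn ℚ {p : Fin 2 → ℝ | p 0 ∈ Ioo (0 : ℝ) 1}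
      (fun q => q 1 - g (q 0)) := IsSemialgebraicFunOn.sub_holds h1 hg0
  have hp1 : IsSemialgebraic ℚ {p : Fin 2 → ℝ | 0 < p 1} := by
    simpa using isSemialgebraic_setOf_eval_pos (k := ℚ) (R := ℝ)
      (MvPolynomial.X 1 : MvPolynomial (Fin 2) ℚ)
  convert hp1.inter hG.isSemialgebraic_sep_neg using 1
  ext p
  simp only [mem_setOf_eq, mem_inter_iff, sub_neg]
  tauto

/-- The cell under a density bounded above on `(0, 1)` lies in a box, hence has finite area.
[folklore] -/
theorem chainToPlanar_volume_cell_ne_top {g : ℝ → ℝ} {C : ℝ}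
    (hC : ∀ x ∈ Ioo (0 : ℝ) 1, g x ≤ C) :
    volume {p : Fin 2 → ℝ | p 0 ∈ Ioo (0 : ℝ) 1 ∧ 0 < p 1 ∧ p 1 < g (p 0)} ≠ ⊤ := by
  refine ((measure_mono ?_).trans_lt
    (volume_box_ne_top (![0, 0] : Fin 2 → ℝ) (![1, C] : Fin 2 → ℝ)).lt_top).ne
  intro p hp
  rw [mem_box]
  intro i
  fin_cases i
  · simpa using hp.1
  · simpa using ⟨hp.2.1, hp.2.2.trans_le (hC _ hp.1)⟩

/-! ## Rule 2 with `|det| = 1` and the affine renormalisation of a piece -/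

/-- **Rule 2 with `|det| = 1` inside the planar sets.** A `ℚ`-semialgebraic injective map,
differentiable within the domain with `|det| = 1`, carries a planar integrand-`1` representation to
the integrand-`1` representation on the image (finite area by the Jacobian formula), in
`planarGroup`. [Kontsevich–Zagier 2001, §1.2, rule (2); folklore] -/
theorem chainToPlanar_cov_move (r : KZ.IntegralRep 2) (hr1 : ∀ p ∈ r.domain, r.integrand p = 1)
    {Φ : (Fin 2 → ℝ) → Fin 2 → ℝ} {Φ' : (Fin 2 → ℝ) → (Fin 2 → ℝ) →L[ℝ] Fin 2 → ℝ}
    (hsa : IsSemialgebraicMapOn ℚ r.domain Φ)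
    (hd : ∀ p ∈ r.domain, HasFDerivWithinAt Φ (Φ' p) r.domain p) (hinj : InjOn Φ r.domain)
    (hdet : ∀ p ∈ r.domain, |(Φ' p).det| = 1) :
    ∃ r' : KZ.IntegralRep 2, r'.domain = Φ '' r.domain ∧ (r'.integrand = fun _ => 1) ∧
      KZ.of r - KZ.of r' ∈ planarGroup := by
  -- adapted from `MordellWeil.cov_move` (SymplecticScissorsPlanarK0InjectiveCellReading)
  have hm := KZ.IntegralRep.measurableSet_domain_holds r
  have hfin : volume (Φ '' r.domain) ≠ ⊤ := by
    rw [← lintegral_abs_det_fderiv_eq_addHaar_image volume hm hd hinj,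
      setLIntegral_congr_fun hm fun p hp => by rw [hdet p hp]]
    simpa using (volume_domain_lt_top_of_integrand_one r hr1).ne
  obtain ⟨r', h1, h2⟩ := KZ.exists_oneRep
    (IsSemialgebraicMapOn.isSemialgebraic_image_holds hsa Subset.rfl r.isSemialgebraic_domain) hfin
  exact ⟨r', h1, h2, of_sub_of_mem_planarGroup_of_cov hr1 (fun p _ => by rw [h2])
    ⟨2, r, r', Φ, Φ', hsa, hd, hinj, h1, fun p hp => by rw [hr1 p hp, h2, hdet p hp]; simp, rfl⟩⟩

/-- **Affine renormalisation of a piece.** The integrand-`1` representation on the piece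
`{a < x < b, 0 < y < F x}` (`a < b` rational) is congruent in `planarGroup` to an integrand-`1`
representation on the standard cell of the rescaled density `u ↦ (b − a) F (a + (b − a) u)`, by the
single rule-2 map `(x, y) ↦ ((x − a)/(b − a), (b − a) y)` of determinant `1`.
[Kontsevich–Zagier 2001, §1.2, rule (2); folklore] -/
theorem chainToPlanar_affine_piece {a b : ℚ} (hab : a < b) {F : ℝ → ℝ} (r : KZ.IntegralRep 2)
    (hrd : r.domain = {p : Fin 2 → ℝ | p 0 ∈ Ioo (a : ℝ) b ∧ 0 < p 1 ∧ p 1 < F (p 0)})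
    (hr1 : ∀ p ∈ r.domain, r.integrand p = 1) :
    ∃ r' : KZ.IntegralRep 2,
      r'.domain = {q : Fin 2 → ℝ | q 0 ∈ Ioo (0 : ℝ) 1 ∧ 0 < q 1 ∧
        q 1 < ((b : ℝ) - a) * F (a + ((b : ℝ) - a) * q 0)} ∧
      (∀ p ∈ r'.domain, r'.integrand p = 1) ∧ KZ.of r - KZ.of r' ∈ planarGroup := by
  -- adapted from `MordellWeil.sbb` (SymplecticScissorsPlanarK0InjectiveCellReading): the affine
  -- renormalisation `Ψ (x, y) = ((x - a)/d, d y)`, `d = b - a`, `det = 1`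
  set d : ℝ := (b : ℝ) - a with hd_def
  have hd : 0 < d := sub_pos.2 (by exact_mod_cast hab)
  set L : (Fin 2 → ℝ) →L[ℝ] (Fin 2 → ℝ) :=
    ContinuousLinearMap.pi ![d⁻¹ • ContinuousLinearMap.proj 0, d • ContinuousLinearMap.proj 1]
    with hL
  set Ψ : (Fin 2 → ℝ) → (Fin 2 → ℝ) := fun p => ![(p 0 - a) / d, d * p 1] with hΨ
  have hΨL : Ψ = fun p => L p + ![-(a : ℝ) / d, 0] := by
    funext p; ext i; fin_cases i; (· simp [hΨ, hL]; ring); simp [hΨ, hL]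
  have hdet : L.det = 1 := by
    rw [hL, ContinuousLinearMap.det, ← LinearMap.det_toMatrix', Matrix.det_fin_two]
    simp [LinearMap.toMatrix'_apply, hd.ne']
  have hinj : InjOn Ψ r.domain := by
    intro p _ q _ h
    have h0 : (p 0 - a) / d = (q 0 - a) / d := by simpa [hΨ] using congrFun h 0
    have h1 : d * p 1 = d * q 1 := by simpa [hΨ, hd.ne'] using congrFun h 1
    rw [div_left_inj' hd.ne', sub_left_inj] at h0
    ext i; fin_cases i; exacts [h0, mul_left_cancel₀ hd.ne' h1]
  have hsa : IsSemialgebraicMapOn ℚ r.domain Ψ := by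
    have hs := r.isSemialgebraic_domain
    have hdq : IsSemialgebraicFunOn ℚ r.domain fun _ => d :=
      (isSemialgebraicFunOn_ratCast hs (b - a)).congr fun _ _ => by simp [hd_def]
    refine IsSemialgebraicMapOn.of_forall hs (Fin.forall_fin_two.2 ⟨?_, ?_⟩)
    · exact ((IsSemialgebraicFunOn.sub_holds (isSemialgebraicFunOn_apply hs 0)
        (isSemialgebraicFunOn_ratCast hs a)).div hdq fun _ _ => hd.ne').congr
          fun p _ => by simp [hΨ]
    · exact (IsSemialgebraicFunOn.mul_holds hdq (isSemialgebraicFunOn_apply hs 1)).congr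
        fun p _ => by simp [hΨ]
  obtain ⟨c, hcd, hci, hcov⟩ := chainToPlanar_cov_move r hr1 hsa (Φ' := fun _ => L)
    (fun p _ => by rw [hΨL]; exact (L.hasFDerivAt.add_const _).hasFDerivWithinAt) hinj
    (fun p _ => by simp [hdet])
  refine ⟨c, ?_, fun p _ => by rw [hci], hcov⟩
  rw [hcd, hrd]
  ext q
  constructor
  · rintro ⟨p, ⟨h0, h1, h2⟩, rfl⟩
    have hx : (a : ℝ) + d * ((p 0 - a) / d) = p 0 := by field_simp; ring
    simp only [hΨ, mem_setOf_eq, Matrix.cons_val_zero, Matrix.cons_val_one, Matrix.cons_val_fin_one,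
      hx, mem_Ioo]
    exact ⟨⟨div_pos (sub_pos.2 h0.1) hd, (div_lt_one hd).2 (by linarith [h0.2])⟩, mul_pos hd h1,
      mul_lt_mul_of_pos_left h2 hd⟩
  · rintro ⟨h0, h1, h2⟩
    refine ⟨![a + d * q 0, q 1 / d], ⟨?_, by simp; positivity, ?_⟩, ?_⟩
    · simp only [Matrix.cons_val_zero, mem_Ioo]
      have h3 : d * q 0 < d := mul_lt_of_lt_one_right hd h0.2
      exact ⟨lt_add_of_pos_right _ (mul_pos hd h0.1), by linarith⟩
    · simp only [Matrix.cons_val_one, Matrix.cons_val_fin_one, Matrix.cons_val_zero] at h2 ⊢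
      rw [div_lt_iff₀ hd]; linarith
    · ext i; fin_cases i <;> simp [hΨ] <;> field_simp

/-! ## Edge densities of cubes mapping into `S` -/

/-- The edge density `t ↦ Σᵢ Pᵢ (c t) · (∂c(t) e₀)ᵢ` of a `ℚ`-semialgebraic `C¹` 1-cube mapping the
closed unit interval into `S`, for a `ℚ`-semialgebraic continuous `P` on `S`, is `ℚ`-semialgebraic
on `(0, 1)` and bounded there (semialgebraic and continuous on the compact `[0, 1]`).
[Bochnak–Coste–Roy 1998, Prop. 2.2.6; folklore] -/
theorem chainToPlanar_dens_sa_bdd {N : ℕ} {S : Set (Fin N → ℝ)} {P : (Fin N → ℝ) → (Fin N → ℝ)}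
    (hSsa : IsSemialgebraic ℚ S) (hP : IsSemialgebraicMapOn ℚ S P) (hPc : ContinuousOn P S)
    (c : NashCubeMap 1 N) (hc : MapsTo (fun w => c w) (closedUnitCube 1) S) :
    IsSemialgebraicFunOn ℚ {z : Fin 1 → ℝ | z 0 ∈ Ioo (0 : ℝ) 1}
        (fun z => ∑ i' : Fin N, P (c (fun _ => z 0)) i' *
          fderiv ℝ (fun w => c w) (fun _ => z 0) (Pi.single 0 1) i') ∧
      ∃ C : ℝ, ∀ s ∈ Ioo (0 : ℝ) 1, |∑ i' : Fin N, P (c (fun _ => s)) i' *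
          fderiv ℝ (fun w => c w) (fun _ => s) (Pi.single 0 1) i'| ≤ C := by
  have hconst : ∀ z : Fin 1 → ℝ, (fun _ : Fin 1 => z 0) = z := fun z => by
    funext i; rw [Subsingleton.elim i 0]
  -- the density as a function on the closed cube
  have hsa : IsSemialgebraicFunOn ℚ (closedUnitCube 1)
      (fun z => ∑ i' : Fin N, P (c z) i' * fderiv ℝ (fun w => c w) z (Pi.single 0 1) i') := by
    refine isSemialgebraicFunOn_finsetSum _ isSemialgebraic_closedUnitCube fun i' _ => ?_
    exact IsSemialgebraicFunOn.mul_holds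
      (IsSemialgebraicFunOn.comp_isSemialgebraicMapOn_holds
        ((isSemialgebraicMapOn_iff_forall_holds hSsa).mp hP i') c.isSemialgebraicMapOn hc)
      (c.isSemialgebraicFunOn_fderiv 0 i')
  have hcont : ContinuousOn
      (fun z => ∑ i' : Fin N, P (c z) i' * fderiv ℝ (fun w => c w) z (Pi.single 0 1) i')
      (closedUnitCube 1) := by
    obtain ⟨U, hU, hsub, hcU⟩ := c.exists_contDiffOn
    have hD : ContinuousOn (fderiv ℝ (fun w => c w)) U :=
      hcU.continuousOn_fderiv_of_isOpen hU le_rfl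
    refine continuousOn_finsetSum _ fun i' _ => ContinuousOn.mul ?_ ?_
    · exact (continuous_apply i').comp_continuousOn (hPc.comp c.continuousOn hc)
    · exact (continuous_apply i').comp_continuousOn
        (((continuous_eval_const (Pi.single 0 (1 : ℝ) : Fin 1 → ℝ)).comp_continuousOn hD).mono
          hsub)
  obtain ⟨C, hC⟩ := isCompact_closedUnitCube.exists_bound_of_continuousOn hcont
  have hIoo : {z : Fin 1 → ℝ | z 0 ∈ Ioo (0 : ℝ) 1} ⊆ closedUnitCube 1 := fun z hz =>
    mem_closedUnitCube_iff.mpr fun i => by rw [Subsingleton.elim i 0]; exact Ioo_subset_Icc_self hz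
  have h01 : IsSemialgebraic ℚ {z : Fin 1 → ℝ | z 0 ∈ Ioo (0 : ℝ) 1} := by
    simpa only [mem_Ioo] using isSemialgebraic_unitInterval_fin_one
  refine ⟨(hsa.mono hIoo h01).congr fun z _ => ?_, C, fun s hs => ?_⟩
  · exact congrArg
      (fun y : Fin 1 → ℝ => ∑ i' : Fin N, P (c y) i' * fderiv ℝ (fun w => c w) y (Pi.single 0 1) i')
      (hconst z).symm
  · have hmem : (fun _ : Fin 1 => s) ∈ closedUnitCube 1 :=
      mem_closedUnitCube_iff.mpr fun _ => Ioo_subset_Icc_self hs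
    simpa only [Real.norm_eq_abs] using hC _ hmem

/-! ## Registered anchor -/

/-- Registered anchor of this helper file (crux protocol `--supports`): the affine
renormalisation of a piece onto a standard cell (`chainToPlanar_affine_piece`).
[Kontsevich–Zagier 2001, §1.2; folklore] -/
theorem helper_chainToPlanar_1 :
    ∀ (a b : ℚ), a < b → ∀ (F : ℝ → ℝ) (r : KZ.IntegralRep 2),
      r.domain = {p : Fin 2 → ℝ | p 0 ∈ Set.Ioo (a : ℝ) b ∧ 0 < p 1 ∧ p 1 < F (p 0)} →
      (∀ p ∈ r.domain, r.integrand p = 1) →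
      ∃ r' : KZ.IntegralRep 2,
        r'.domain = {q : Fin 2 → ℝ | q 0 ∈ Set.Ioo (0 : ℝ) 1 ∧ 0 < q 1 ∧
          q 1 < ((b : ℝ) - a) * F (a + ((b : ℝ) - a) * q 0)} ∧
        (∀ p ∈ r'.domain, r'.integrand p = 1) ∧ KZ.of r - KZ.of r' ∈ planarGroup :=
  fun _ _ hab _ r hrd hr1 => chainToPlanar_affine_piece hab r hrd hr1

end Summit.KontsevichZagierPeriods.SymplecticScissors.KernelSubgroupHomotopy

end
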